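import Mathlib.Algebra.Polynomial.Div
import Mathlib.RingTheory.TensorProduct.Finite
import Literature.NumberTheory.Automorphic.LocalConstants
import HarnessLib

/-!
# Henniart's Galois-side characterisation theorems (Bull. SMF 130 (2002)), named facts

Source: G. Henniart, *Une caractérisation de la correspondance de Langlands locale pour `GL(n)`*,
Bull. Soc. Math. France **130** (2002), 587–602 [HenniartBSMF2002].  Conventions (§1.1–§1.2): `F` a
non-archimedean local field, `ψ` a fixed non-trivial character of `F`, `q` the residue cardinality;
"représentation de `W'_F`" = complex finite-dimensional `Φ`-semisimple (Frobenius-semisimple)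
Weil–Deligne representation; `G(n)` = isomorphism classes of those of dimension `n`, `G⁰(n) ⊂ G(n)`
the irreducible ones, `G²(n)` the indecomposable ones; `L(s, σ) = P(q^{-s})⁻¹` with `P ∈ ℂ[X]`,
`P(0) = 1`; `ε(s, σ, ψ)` the Langlands–Deligne local constant and
`γ(s, σ, ψ) = ε(s, σ, ψ) L(1 - s, σ^∨) / L(s, σ)` ([10, §4] = Tate, Corvallis 1979, §4); class field
theory normalised "geometric Frobenius ↔ uniformiser" (the tree's `LocalArtinData.artin_frob`).

## The two printed statements and their tree forms

* **§1.4, Corollaire** (p. 590): *`n ≥ 2`, `σ, σ' ∈ G⁰(n)`; if `γ(s, σ ⊗ τ, ψ) = γ(s, σ' ⊗ τ, ψ)`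
  for `r = 1, …, n - 1` and all `τ ∈ G⁰(r)`, then `σ = σ'`* (= Henniart 1993, Thm. 1.1, Cor.,
  transported through the local Langlands correspondence of Thm. 1.3; "aucune démonstration directe
  de ce corollaire n'est connue").  Tree form
  `Henniart2002_irreducible_isEquivalent_of_epsilonWD_eq`: the `ε`-FORM (hypothesis
  `ε(s, σ ⊗ τ, ψ) = ε(s, σ' ⊗ τ, ψ)` for all `s`), EQUIVALENT in print: for `σ` irreducible of
  dimension `n` and `τ` of dimension `r < n` one has `L(s, σ ⊗ τ) = L(s, σ^∨ ⊗ τ^∨) = 1` and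
  `γ(s, σ ⊗ τ, ψ) = ε(s, σ ⊗ τ, ψ)` (§3.1, proving Thm. 1.6 (a) (i) ⇒ (ii), (iii); the Galois side
  of the Remarque of §1.4).  The tree has Deligne's `ε` of a Weil–Deligne representation
  (`epsilonWD`, file `LocalConstants`) but no `γ`-factor.
* **§1.7, Théorème (a)** (p. 591): for `σ ∈ G(n)` let `v_r(σ) : G²(r) → ℕ` send `τ` to the order
  of the pole of `L(s, σ ⊗ τ)` at `s = 0`.  *`n ≥ 2`, `σ ∈ G(n) ∖ G⁰(n)`, `σ' ∈ G(n)`; if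
  `v_r(σ) = v_r(σ')` for `r = 1, …, n - 1`, then `σ = σ'`.*  Tree form
  `Henniart2002_isEquivalent_of_rootMultiplicity_eulerFactor_tprod_eq`: as
  `L(s, σ ⊗ τ) = P(q^{-s})⁻¹` with `P = eulerFactor (σ ⊗ τ)`, `P(0) = 1`
  (`WeilDeligneRep.eulerFactor_coeff_zero`), and `s ↦ 1 - q^{-s}` has a simple zero at `s = 0`,
  the pole order at `s = 0` is the multiplicity of the root `X = 1` of `P` (Mathlib
  `Polynomial.rootMultiplicity 1 P`): `v_r` is transcribed verbatim.  The EULER-FACTOR FORM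
  (hypothesis `P_{σ ⊗ τ} = P_{σ' ⊗ τ}`, which is what a correspondence preserving `L`-factors of
  pairs delivers) is the proved corollary
  `Henniart2002_isEquivalent_of_eulerFactor_tprod_indecomposable_eq`.

Modelling.  `σ, σ'` live on `Fin n → ℂ` and the probes `τ` on `Fin r → ℂ` ("dimension" is literal;
this is the format of the parameters of `IsLocalLanglandsGL`); every class in `G(n)` has such a
model and `L`, `ε`, `γ` are class functions (Remarque of §1.2).  The printed `ε` is Deligne's,
normalised (Deligne 1973, (4.1.2)) against THE Artin maps of class field theory: fact (A)
quantifies over the systems of local constants `𝓔 : LocalEpsilonSystem F` whose Artin data are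
canonical at every finite extension, `(𝓔.artin E).IsCanonical` (they exist by Deligne's theorem and
all have Deligne's `ε₀` by `localEpsilonSystem_unique`, Deligne 1973, Thm. 4.1), over ONE continuous
non-trivial `ψ` as in print, and ONE Haar measure `μ` on `F` (print: `dx` self-dual for `ψ`; for an
equality of the `ε` of two representations of the same dimension `n r` the Haar measure is
immaterial, `ε₀(ρ, ψ, c μ) = c ^ dim ρ ε₀(ρ, ψ, μ)`, axiom `measure_smul`).  The `LocalGaloisGroup`
named facts `hmul huniq hn hex` consumed by `epsilonWD` / `eulerFactor` are threaded (D-0014).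

## Why (prose only; a Literature file imports no `Summits.*`)

Rigidity of PINNED local Langlands data above the supercuspidal floor (summit `Langlands`, route
`IrreducibilityBySelfDuality`, item `ReciprocityUpToIrreducibilityR`, stub
`stub_genericRigidity_three_le`; also item 18745): two six-clause local Langlands data over `F_v`
normalised against the canonical Artin map and canonical local constants agree on supercuspidal
classes (Henniart 1993, the uniqueness half of `localLanglands_gl`); in ranks `n ≥ 3` the induction
over the remaining generic classes consumes exactly the two Galois-side statements of this file.

## Deliberately NOT here

* Thm. 1.6 (`σ ∈ G⁰(n)` iff `L(s, σ ⊗ τ) = 1` for all `τ ∈ G⁰(r)`, `r < n`, iff the `γ` are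
  monomials; and (b)): elementary on the Galois side, proved as `Summits`-side lemmas where needed.
* Thm. 1.8 and the Corollaire of §1.8 (the family-level characterisation of `(π_n)_n`), Cor. 1.6,
  §1.9; every automorphic-side statement (Thm. 1.4, Thm. 1.6 (b), Thm. 1.7 (b), Prop. 1.9).
* The discharges `…_holds` (Henniart's proofs go through the local Langlands correspondence and the
  classification of `G(n)` by segments, §2–§4).
-/

open MeasureTheory Polynomial

namespace Literature.NumberTheory.GaloisRepresentations

open Literature.NumberTheory.Automorphic

/-- **Henniart 2002, §1.4 Corollaire, `ε`-form** (named fact, D-0014).  Let `n ≥ 2` and let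
`σ, σ'` be irreducible Frobenius-semisimple `n`-dimensional complex Weil–Deligne representations of
`W_F`.  If `ε(s, σ ⊗ τ, ψ) = ε(s, σ' ⊗ τ, ψ)` for all `s ∈ ℂ` and every irreducible
Frobenius-semisimple `τ` of dimension `r`, `1 ≤ r ≤ n - 1`, then `σ ≅ σ'`.  Here `ε` is Deligne's
`ε`-factor `epsilonWD … 𝓔 ψ μ` for a system of local constants `𝓔` normalised against THE Artin
maps (`(𝓔.artin E).IsCanonical` at every finite `E/F`), a fixed continuous non-trivial `ψ` and a
fixed Haar measure `μ` (all such `𝓔` have Deligne's `ε₀` by `localEpsilonSystem_unique`; the Haar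
measure only scales both sides by the same `c ^ (n r)`, axiom `measure_smul`).  Print states the
hypothesis with `γ(s, σ ⊗ τ, ψ)`; for `σ` irreducible of dimension `n` and `τ` of dimension
`r < n` one has `L(s, σ ⊗ τ) = L(s, σ^∨ ⊗ τ^∨) = 1` and `γ(s, σ ⊗ τ, ψ) = ε(s, σ ⊗ τ, ψ)` (loc.
cit., §3.1; Thm. 1.6 (a) and the Remarque of §1.4), so the two forms are equivalent.  No direct
(Galois-side) proof is known: it is Henniart 1993, Thm. 1.1, Cor., transported through the local
Langlands correspondence (Thm. 1.3). [cite: HenniartBSMF2002, Cor. 1.4] -/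
def Henniart2002_irreducible_isEquivalent_of_epsilonWD_eq (F : Type) [Field F] [ValuativeRel F]
    [TopologicalSpace F] [IsNonarchimedeanLocalField F] : Prop :=
  ∀ (hmul : IsFrobPow.mul (F := F)) (huniq : IsFrobPow.unique (F := F))
    (hn : absInertia_normal F) (hex : exists_isFrobPow (F := F)) (𝓔 : LocalEpsilonSystem F),
    (∀ (E : Type) [Field E] [ValuativeRel E] [TopologicalSpace E] [IsNonarchimedeanLocalField E]
      [Algebra F E] [FiniteDimensional F E], (𝓔.artin E).IsCanonical) →
    ∀ [MeasurableSpace F] [BorelSpace F] (ψ : AddChar F Circle), ψ.IsContinuousNontrivial →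
    ∀ (μ : Measure F) [μ.IsAddHaarMeasure] (n : ℕ), 2 ≤ n →
    ∀ (σ σ' : WeilDeligneRep F ℂ (Fin n → ℂ)), σ.IsFrobSemisimple → σ'.IsFrobSemisimple →
      σ.IsIrreducible → σ'.IsIrreducible →
      (∀ (r : ℕ), 0 < r → r < n → ∀ τ : WeilDeligneRep F ℂ (Fin r → ℂ), τ.IsFrobSemisimple →
        τ.IsIrreducible → ∀ s : ℂ,
          epsilonWD hmul huniq hn hex 𝓔 ψ μ (σ.tprod τ) s =
            epsilonWD hmul huniq hn hex 𝓔 ψ μ (σ'.tprod τ) s) →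
      σ.IsEquivalent σ'

/-- **Henniart 2002, §1.7 Théorème (a)** (named fact, D-0014).  For a Frobenius-semisimple
Weil–Deligne representation `σ` and an indecomposable Frobenius-semisimple `τ` put
`v(σ)(τ) :=` the order of the pole of `L(s, σ ⊗ τ) = P_{σ ⊗ τ}(q^{-s})⁻¹` at `s = 0`, i.e. — since
`P_{σ ⊗ τ}(0) = 1` and `1 - q^{-s}` has a simple zero at `s = 0` — the multiplicity of the root
`X = 1` of the Euler factor `P_{σ ⊗ τ} = (σ.tprod τ).eulerFactor hn hex`
(`Polynomial.rootMultiplicity 1`).  Let `n ≥ 2`, let `σ` be Frobenius-semisimple of dimension `n`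
and NOT irreducible, and `σ'` Frobenius-semisimple of dimension `n`.  If `v(σ)(τ) = v(σ')(τ)` for
every indecomposable Frobenius-semisimple `τ` of dimension `r`, `1 ≤ r ≤ n - 1`, then `σ ≅ σ'`.
(The proof, §4, reconstructs `σ` from the functions `v_r(σ)` via the classification by segments.)
[cite: HenniartBSMF2002, Thm. 1.7 (a)] -/
def Henniart2002_isEquivalent_of_rootMultiplicity_eulerFactor_tprod_eq (F : Type*) [Field F]
    [ValuativeRel F] [TopologicalSpace F] [IsNonarchimedeanLocalField F] : Prop :=
  ∀ (hn : absInertia_normal F) (hex : exists_isFrobPow (F := F)) (n : ℕ), 2 ≤ n →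
    ∀ (σ σ' : WeilDeligneRep F ℂ (Fin n → ℂ)), σ.IsFrobSemisimple → σ'.IsFrobSemisimple →
      ¬ σ.IsIrreducible →
      (∀ (r : ℕ), 0 < r → r < n → ∀ τ : WeilDeligneRep F ℂ (Fin r → ℂ), τ.IsFrobSemisimple →
        τ.IsIndecomposable →
          rootMultiplicity 1 ((σ.tprod τ).eulerFactor hn hex) =
            rootMultiplicity 1 ((σ'.tprod τ).eulerFactor hn hex)) →
      σ.IsEquivalent σ'

/-- **Euler-factor form of Henniart 2002, Thm. 1.7 (a)** (proved from the named fact): under the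
same standing hypotheses, if the Euler factors themselves agree, `P_{σ ⊗ τ} = P_{σ' ⊗ τ}` — i.e.
`L(s, σ ⊗ τ) = L(s, σ' ⊗ τ)` — for every indecomposable Frobenius-semisimple `τ` of dimension
`r`, `1 ≤ r ≤ n - 1`, then `σ ≅ σ'` (equal polynomials have equal root multiplicities at `1`).
This is the form delivered by two local Langlands correspondences preserving `L`-factors of pairs.
[cite: HenniartBSMF2002, Thm. 1.7 (a)] -/
theorem Henniart2002_isEquivalent_of_eulerFactor_tprod_indecomposable_eq {F : Type*} [Field F]
    [ValuativeRel F] [TopologicalSpace F] [IsNonarchimedeanLocalField F]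
    (h : Henniart2002_isEquivalent_of_rootMultiplicity_eulerFactor_tprod_eq F)
    (hn : absInertia_normal F) (hex : exists_isFrobPow (F := F)) {n : ℕ} (h2 : 2 ≤ n)
    {σ σ' : WeilDeligneRep F ℂ (Fin n → ℂ)} (hσ : σ.IsFrobSemisimple) (hσ' : σ'.IsFrobSemisimple)
    (hirr : ¬ σ.IsIrreducible)
    (H : ∀ (r : ℕ), 0 < r → r < n → ∀ τ : WeilDeligneRep F ℂ (Fin r → ℂ), τ.IsFrobSemisimple →
      τ.IsIndecomposable → (σ.tprod τ).eulerFactor hn hex = (σ'.tprod τ).eulerFactor hn hex) :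
    σ.IsEquivalent σ' :=
  h hn hex n h2 σ σ' hσ hσ' hirr fun r hr hrn τ hτ hτ' => by rw [H r hr hrn τ hτ hτ']

end Literature.NumberTheory.GaloisRepresentations
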